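import Summits.CriticalPhenomena.Ising3DConformalLimit.Theorems.EnergyNotSigmaSquaredGapForcesFarMergingSandwichDefs
import Summits.CriticalPhenomena.Ising3DConformalLimit.Theorems.GapForcesFarMerging.Negative.IsingCertificate
import Literature.Probability.LatticeModels.SharpnessProofs
import Literature.Probability.LatticeModels.MessagerMiracleSole
import Literature.Probability.LatticeModels.TwoSiteNumerics
import HarnessLib

/-!
# Abundance of doubling octaves (quantitative pigeonhole along the first axis)
# (line `one-cluster-depletion-sandwich` of crux `GapForcesFarMerging`, item stmt-CriticalPhenomena-4468;
# helper file 4 for the registered stub `stub_meetDomination`)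

The per-octave currencies of the line (`MeetDomination`, `AvoidanceDomination`, `HazardDominationExt`) compare the
one-pinch system at octave `k` with fresh dilated shapes at scales `2^j`, `|j - k| = O(1)`; every such comparison
passes through the exact one-point densities `G_n(a,v)G_n(v,b)/G_n(a,b)` at separations `≍ 2^k` in different
directions and therefore needs the two-point function to be REGULAR at scale `2^k` (Aizenman–Duminil-Copin 2021,
Assumption 4.1 / §5.6 Def. 5.11 (P1): regular scales; unconditionally only ABUNDANT, Thm 5.12). In the vocabulary of
the Defs module regularity at octave `k` is the doubling window `Doubling θ k`. This file proves that doubling octaves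
are abundant in the quantitative form needed by an octave counting over `1 ≤ k ≤ 5K+3`:

* `G_axis_succ_le` : `G(2^{j+1}e₁) ≤ G(2^j e₁)` (Messager–Miracle-Solé along the axis);
* `card_badOctave_le` : the number of `j < J` with `G(2^{j+1}e₁) < θ·G(2^j e₁)` is at most
  `(J·log 4 + log(1/c)) / log(1/θ)` (telescoping `∏_{j<J} G(2^{j+1}e₁)/G(2^j e₁) = G(2^J e₁)/G(e₁) ≥ c·4^{-J}`, from
  `c‖x‖⁻² ≤ G(x) ≤ 1`);
* `card_not_doubling_le` (registered as `meetDomination_doublingAbundance`): for `0 < θ < 1` there is `b` with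
  `#{k ≤ N : ¬ Doubling θ k} ≤ (7·log 4·N + b)/log(1/θ)` for all `N` (each bad `j` spoils at most `7` windows).
Everything is proved; no definition and no named fact is introduced.

References: M. Aizenman, H. Duminil-Copin, Ann. of Math. 194 (2021) = arXiv:1912.07973, §5.1 (5.3), §5.6 Def. 5.11,
Thm 5.12 [AizenmanDuminilCopinAnnals2021]; A. Messager, S. Miracle-Solé, J. Stat. Phys. 17 (1977) [MessagerMiracleSoleJSP1977].
-/

noncomputable section

namespace Summit.CriticalPhenomena.Ising3DConformalLimit.EnergyNotSigmaSquaredGapForcesFarMergingSandwich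

namespace MeetDominationProof

open Filter Finset
open Literature.Probability.LatticeModels
open Summit.CriticalPhenomena.Ising3DConformalLimit.GapForcesFarMergingSandwich
open Summit.CriticalPhenomena.Ising3DConformalLimit.Theorems.GapForcesFarMerging.Negative (cc2 softPackageNoBubble_criticalCorr)

/-! ## §1. The critical two-point function along the dyadic points of the first axis -/

/-- `2^j e₁` as a single-coordinate site. [folklore] -/
theorem pow_smul_e₁ (j : ℕ) : ((2 : ℤ) ^ j) • e₁ = (Pi.single 0 ((2 : ℤ) ^ j) : Site 3) := by
  ext i
  by_cases hi : i = 0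
  · subst hi; simp
  · simp [hi]

/-- `2^j e₁ ≠ 0`. [folklore] -/
theorem pow_smul_e₁_ne_zero (j : ℕ) : ((2 : ℤ) ^ j) • e₁ ≠ (0 : Site 3) := by
  intro h
  have h0 := congrFun h 0
  simp at h0

/-- `‖2^j e₁‖ = 2^j` (sup norm). [folklore] -/
theorem norm_pow_smul_e₁ (j : ℕ) : ‖((2 : ℤ) ^ j) • e₁‖ = (2 : ℝ) ^ j := by
  rw [pow_smul_e₁, Site.norm_eq_supNorm, supNorm_single_pow]
  push_cast
  rfl

/-- `G(x) = ⟨σ₀σ_x⟩ = cc2 0 x`. [folklore] -/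
theorem G_eq_cc2 (x : Site 3) : G x = cc2 0 x := softPackageNoBubble_criticalCorr.two x

/-- `0 < G(2^j e₁) ≤ 1`. [folklore] -/
theorem G_axis_pos_le_one (j : ℕ) : 0 < G (((2 : ℤ) ^ j) • e₁) ∧ G (((2 : ℤ) ^ j) • e₁) ≤ 1 := by
  rw [G_eq_cc2]
  exact ⟨softPackageNoBubble_criticalCorr.pos _ _, softPackageNoBubble_criticalCorr.le_one _ _⟩

/-- **Lower bound along the axis**: `G(2^j e₁) ≥ c·4^{-j}` with the constant of `c‖x‖⁻² ≤ G(x)`. [folklore] -/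
theorem G_axis_lower : ∃ c : ℝ, 0 < c ∧ ∀ j : ℕ, c * ((4 : ℝ) ^ j)⁻¹ ≤ G (((2 : ℤ) ^ j) • e₁) := by
  obtain ⟨c, hc, hlow⟩ := softPackageNoBubble_criticalCorr.lower
  refine ⟨c, hc, fun j => ?_⟩
  have h := hlow _ (pow_smul_e₁_ne_zero j)
  rw [norm_pow_smul_e₁, Real.rpow_neg (by positivity), Real.rpow_two, ← pow_mul,
    show (2 : ℝ) ^ (j * 2) = 4 ^ j by rw [mul_comm, pow_mul]; norm_num] at h
  rwa [G_eq_cc2]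

/-- **Messager–Miracle-Solé along the axis**: `G(2^{j+1}e₁) ≤ G(2^j e₁)`. [cite: MessagerMiracleSoleJSP1977, main theorem (monotonicity of ⟨σ₀σ_x⟩ along a coordinate axis)] -/
theorem G_axis_succ_le (j : ℕ) : G (((2 : ℤ) ^ (j + 1)) • e₁) ≤ G (((2 : ℤ) ^ j) • e₁) := by
  have h := twoPointPlus_add_single_le (messager_miracleSole_holds (d := 3) (β := criticalBeta 3))
    (criticalBeta_nonneg 3) (((2 : ℤ) ^ j) • e₁) 0 (by simp) (2 ^ j)
  have heq : ((2 : ℤ) ^ j) • e₁ + Pi.single 0 (((2 ^ j : ℕ) : ℤ)) = ((2 : ℤ) ^ (j + 1)) • (e₁ : Site 3) := by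
    rw [pow_smul_e₁, pow_smul_e₁, ← Pi.single_add]
    push_cast
    ring_nf
  rw [heq] at h
  exact h

/-! ## §2. Counting the bad octaves -/

/-- **Few sharp drops**: the number of `j < J` with `G(2^{j+1}e₁) < θ·G(2^j e₁)` is at most
`(J·log 4 + log(1/c))/log(1/θ)` — the ratios telescope to `G(2^J e₁)/G(e₁) ≥ c·4^{-J}` and each is `≤ 1`.
[folklore] -/
theorem card_badOctave_le {θ : ℝ} (hθ : 0 < θ) (hθ1 : θ < 1) :
    ∃ c : ℝ, 0 < c ∧ ∀ J : ℕ,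
      ((((range J).filter fun j => G (((2 : ℤ) ^ (j + 1)) • e₁) < θ * G (((2 : ℤ) ^ j) • e₁)).card : ℕ) : ℝ) ≤
        (J * Real.log 4 + Real.log c⁻¹) / Real.log θ⁻¹ := by
  obtain ⟨c, hc, hlow⟩ := G_axis_lower
  refine ⟨c, hc, fun J => ?_⟩
  set a : ℕ → ℝ := fun j => Real.log (G (((2 : ℤ) ^ j) • e₁)) with ha
  set B := (range J).filter fun j => G (((2 : ℤ) ^ (j + 1)) • e₁) < θ * G (((2 : ℤ) ^ j) • e₁) with hB
  have hlogθ : 0 < Real.log θ⁻¹ := Real.log_pos (one_lt_inv₀ hθ |>.2 hθ1)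
  -- each increment is `≤ 0`, and `< log θ` on the bad set
  have hinc : ∀ j, a (j + 1) - a j ≤ 0 := fun j => by
    have := Real.log_le_log (G_axis_pos_le_one (j + 1)).1 (G_axis_succ_le j)
    simp only [ha]; linarith
  have hbad : ∀ j ∈ B, a (j + 1) - a j ≤ Real.log θ := fun j hj => by
    have hlt := (mem_filter.1 hj).2
    have hpos := (G_axis_pos_le_one j).1
    have h := Real.log_le_log (G_axis_pos_le_one (j + 1)).1 hlt.le
    rw [Real.log_mul hθ.ne' hpos.ne'] at h
    simp only [ha]; linarith
  -- telescoping
  have htel : ∑ j ∈ range J, (a (j + 1) - a j) = a J - a 0 := Finset.sum_range_sub a J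
  have hsplit : ∑ j ∈ range J, (a (j + 1) - a j) ≤ (B.card : ℝ) * Real.log θ := by
    have hBsub : B ⊆ range J := filter_subset _ _
    rw [← Finset.sum_sdiff hBsub]
    have h1 : ∑ j ∈ range J \ B, (a (j + 1) - a j) ≤ 0 := Finset.sum_nonpos fun j _ => hinc j
    have h2 : ∑ j ∈ B, (a (j + 1) - a j) ≤ ∑ _j ∈ B, Real.log θ := Finset.sum_le_sum hbad
    rw [Finset.sum_const, nsmul_eq_mul] at h2
    linarith
  -- the endpoints: `a J ≥ log c - J log 4`, `a 0 ≤ 0`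
  have hJ : Real.log c - J * Real.log 4 ≤ a J := by
    have h := Real.log_le_log (by positivity) (hlow J)
    rw [Real.log_mul hc.ne' (by positivity), Real.log_inv, Real.log_pow] at h
    simp only [ha]; linarith
  have h0 : a 0 ≤ 0 := by
    have := Real.log_le_log (G_axis_pos_le_one 0).1 (G_axis_pos_le_one 0).2
    rw [Real.log_one] at this
    exact this
  -- assemble: `#B · log(1/θ) ≤ J log 4 - log c`
  have hkey : (B.card : ℝ) * Real.log θ⁻¹ ≤ J * Real.log 4 + Real.log c⁻¹ := by
    rw [Real.log_inv, Real.log_inv]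
    have := htel ▸ hsplit
    nlinarith
  rw [le_div_iff₀ hlogθ]
  exact hkey

open Classical in
/-- **Abundance of doubling octaves** (quantitative pigeonhole): for `0 < θ < 1` there is `b` such that for every `N`,
`#{k ≤ N : ¬ Doubling θ k} ≤ (7·log 4·N + b)/log(1/θ)` — a non-doubling octave `k` contains a sharp drop
`G(2^{j+1}e₁) < θ G(2^j e₁)` at some `j` with `|j - k| ≤ 3`, each `j` serving at most `7` octaves `k`.
[cite: AizenmanDuminilCopinAnnals2021, §5.6, Theorem 5.12 (abundance of regular scales)] -/
theorem card_not_doubling_le {θ : ℝ} (hθ : 0 < θ) (hθ1 : θ < 1) :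
    ∃ b : ℝ, ∀ N : ℕ, ((((range (N + 1)).filter fun k => ¬ Doubling θ k).card : ℕ) : ℝ) ≤
      (7 * Real.log 4 * N + b) / Real.log θ⁻¹ := by
  obtain ⟨c, hc, hbad⟩ := card_badOctave_le hθ hθ1
  have hlogθ : 0 < Real.log θ⁻¹ := Real.log_pos (one_lt_inv₀ hθ |>.2 hθ1)
  refine ⟨7 * (4 * Real.log 4 + Real.log c⁻¹), fun N => ?_⟩
  set bad : ℕ → Prop := fun j => G (((2 : ℤ) ^ (j + 1)) • e₁) < θ * G (((2 : ℤ) ^ j) • e₁) with hbad_def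
  set B := (range (N + 4)).filter bad with hBdef
  -- a non-doubling `k ≤ N` has a bad `j ≤ N + 3` with `|j - k| ≤ 3`
  have hcover : (range (N + 1)).filter (fun k => ¬ Doubling θ k) ⊆
      B.biUnion fun j => (range (N + 1)).filter fun k => k ≤ j + 3 ∧ j ≤ k + 3 := by
    intro k hk
    rw [mem_filter, mem_range] at hk
    obtain ⟨hkN, hnd⟩ := hk
    simp only [Doubling, not_forall, not_le, exists_prop] at hnd
    obtain ⟨j, hj1, hj2, hlt⟩ := hnd
    rw [mem_biUnion]
    refine ⟨j, mem_filter.2 ⟨mem_range.2 (by omega), hlt⟩, mem_filter.2 ⟨mem_range.2 hkN, hj1, hj2⟩⟩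
  -- each fibre has at most `7` elements
  have hfib : ∀ j, (((range (N + 1)).filter fun k => k ≤ j + 3 ∧ j ≤ k + 3).card) ≤ 7 := fun j => by
    calc _ ≤ (Icc (j - 3) (j + 3)).card := card_le_card fun k hk => by
            rw [mem_filter] at hk; rw [mem_Icc]; omega
      _ ≤ 7 := by rw [Nat.card_Icc]; omega
  have hcard : (((range (N + 1)).filter fun k => ¬ Doubling θ k).card : ℝ) ≤ 7 * B.card := by
    have h := (card_le_card hcover).trans card_biUnion_le
    have h' : ∑ j ∈ B, ((range (N + 1)).filter fun k => k ≤ j + 3 ∧ j ≤ k + 3).card ≤ ∑ _j ∈ B, 7 :=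
      sum_le_sum fun j _ => hfib j
    rw [sum_const, smul_eq_mul] at h'
    have : (((range (N + 1)).filter fun k => ¬ Doubling θ k).card : ℝ) ≤ ((B.card * 7 : ℕ) : ℝ) := by
      exact_mod_cast h.trans h'
    push_cast at this
    linarith
  have hB := hbad (N + 4)
  calc (((range (N + 1)).filter fun k => ¬ Doubling θ k).card : ℝ) ≤ 7 * B.card := hcard
    _ ≤ 7 * ((((N + 4 : ℕ) : ℝ) * Real.log 4 + Real.log c⁻¹) / Real.log θ⁻¹) :=
        mul_le_mul_of_nonneg_left hB (by norm_num)
    _ = (7 * Real.log 4 * N + 7 * (4 * Real.log 4 + Real.log c⁻¹)) / Real.log θ⁻¹ := by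
        push_cast
        field_simp
        ring

end MeetDominationProof

open Filter
open Summit.CriticalPhenomena.Ising3DConformalLimit.GapForcesFarMergingSandwich

open Classical in
/-- **Registered helper `meetDomination_doublingAbundance`** (abundance of doubling octaves along the first axis,
for the octave counting of the line once the per-octave currencies carry `Doubling θ k`): for `0 < θ < 1` there is
`b` with `#{k ≤ N : ¬ Doubling θ k} ≤ (7·log 4·N + b)/log(1/θ)` for every `N`.
[cite: AizenmanDuminilCopinAnnals2021, §5.6, Theorem 5.12 (abundance of regular scales)] -/
theorem meetDomination_doublingAbundance : ∀ θ : ℝ, 0 < θ → θ < 1 → ∃ b : ℝ, ∀ N : ℕ, ((((Finset.range (N + 1)).filter fun k => ¬ Doubling θ k).card : ℕ) : ℝ) ≤ (7 * Real.log 4 * N + b) / Real.log θ⁻¹ :=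
  fun _ hθ hθ1 => MeetDominationProof.card_not_doubling_le hθ hθ1

end Summit.CriticalPhenomena.Ising3DConformalLimit.EnergyNotSigmaSquaredGapForcesFarMergingSandwich

end
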